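import Summits.QuantumFields.QCD.Theses.EulerDescent
import Literature.MathematicalPhysics.QuantumFieldTheory.QCDCurrentSector
import HarnessLib

/-!
# Stub `stub_twistStability_zeroTwist` of line `Sketch` (twisted-ray interface at zero twist)
(crux `Summit.QuantumFields.QCD.Theses.EulerDescent.ChiralCornerSoftness`, item stmt-QuantumFields-16902)

**At zero twisted mass the uniform twisted lattice gap clause `TwGap t 0 Δ` of line `Sketch` is, literally,
the crux's own clause `QCDScheme.HasLatticeMassGap Δ` of the untwisted scheme `reg.scheme (fun _ => t) 0 0`
(degenerate renormalised mass `t`).**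

This is the typing certificate of the twisted-ray interface: the line `Sketch` runs a reductio along the ray
`(t, μ)` with the twisted mass `iμ ψ̄γ₅τ³ψ` on the doublet `(f, g)`; the twisted torus expectation
`E β m₀ μl S X = ∫dμ_W ∫dψ̄dψ X e^{−ψ̄(D_W(U,m₀) + Tw_S(μl))ψ} / ∫dμ_W ∫dψ̄dψ e^{−ψ̄(D_W(U,m₀) + Tw_S(μl))ψ}`
and the clause `TwGap t μ Δ` (uniform exponential clustering of all connected Euclidean-time correlations of
gauge-invariant local observables at rate `Δ a_k`, on every torus of side `2S+1 ≥ 2L_k+1`, at the bare point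
`(m_crit(k) + a_k t/Z_m(k), a_k μ/Z_m(k))`) must reduce, at `μ = 0`, to the untwisted clause.

## Proof (definitional unfolding; nothing is assumed)

* the bare twisted mass at `μ = 0` is `a_k · 0 / Z_m(k) = 0` (`mul_zero`, `zero_div`);
* at `μl = 0` every entry of the twist matrix carries the factor `((0 : ℝ) : ℂ) · i = 0`, so
  `Tw_S(0) = 0` (`ZeroTwist.twist_zero`, by `Matrix.ext`);
* hence the weight is `e^{−ψ̄ D_W(U, m₀) ψ} = fermiBoltzmann U (fun _ => m₀)` and `E β m₀ 0 S` is
  `qcdTorusExpect β (2S+1) (fun _ => m₀)`, the connected correlation is `qcdLatticeConnectedCorr`, and the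
  scheme `reg.scheme (fun _ => t) 0 0` has `a = reg.a`, `β = reg.β`, `L = reg.L`,
  `m_f(k) = m_crit(k) + a_k t / Z_m(k)` by `rfl`; both sides of the `↔` are then the same proposition.

References: R. Frezzotti, P. A. Grassi, S. Sint, P. Weisz, JHEP 08 (2001) 058, §2.1 (twisted-mass lattice
QCD; at zero twist angle it is standard Wilson QCD); I. Montvay, G. Münster, *Quantum Fields on a Lattice*
(CUP 1994), §5.1.
-/

noncomputable section

namespace Summit.QuantumFields.QCD.Cruxes.ChiralCornerSoftness.TwistedRay

open Filter Topology MeasureTheory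
open Literature.MathematicalPhysics.QuantumFieldTheory Literature.MathematicalPhysics.QuantumLattice
  Literature.Probability.LatticeModels

namespace ZeroTwist

/-- **At zero twisted mass the twist matrix `Tw_S(0) = i·0·γ₅τ³` vanishes.** [folklore] -/
theorem twist_zero {Nf : ℕ} (f g : Fin Nf) (S : ℕ) :
    Matrix.reindex (quarkEquiv (Nf := Nf) (L := 2 * S + 1)) quarkEquiv
        (Matrix.of fun v w : QuarkVar Nf (2 * S + 1) =>
          if v.1 = w.1 ∧ v.2.1 = w.2.1 ∧ v.2.2.1 = w.2.2.1 then
            (if v.1 = f then (1 : ℂ) else if v.1 = g then -1 else 0) * ((((0 : ℝ)) : ℂ) * Complex.I) *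
              gammaFive v.2.2.2 w.2.2.2
          else 0) = 0 := by
  ext i j
  simp [Matrix.reindex_apply, Matrix.submatrix_apply, Matrix.of_apply]

/-- The bare twisted mass `a_k · 0 / Z_m(k)` at zero renormalised twist vanishes. [folklore] -/
theorem bareTwist_zero {Nf : ℕ} (reg : QCDRegularisation Nf) (k : ℕ) : reg.a k * 0 / reg.Zm k = 0 := by
  rw [mul_zero, zero_div]

end ZeroTwist

open ZeroTwist in
/-- **At zero twist the twisted uniform lattice gap clause is the untwisted one.** For every
regularisation `reg`, doublet `(f, g)`, degenerate renormalised mass `t` and rate `Δ`, the clause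
`TwGap t 0 Δ` of line `Sketch` (uniform exponential clustering under the twisted torus expectation `E` at
bare point `(m_crit(k) + a_k t / Z_m(k), a_k · 0 / Z_m(k))`) is equivalent to — indeed, after unfolding,
syntactically equal to — `(reg.scheme (fun _ => t) 0 0).HasLatticeMassGap Δ`: the twist matrix vanishes at
`μl = 0`, so the twisted weight is `fermiBoltzmann`, `E` is `qcdTorusExpect`, and the scheme's data are
`(reg.a, reg.β, reg.L, m_crit + a t / Z_m)` by `rfl`. [cite: FrezzottiGrassiSintWeisz2001, §2.1] -/
theorem stub_twistStability_zeroTwist : ∀ (Nf : ℕ) (reg : QCDRegularisation Nf) (f g : Fin Nf) (t Δ : ℝ), let Tw := fun (S : ℕ) (μl : ℝ) => Matrix.reindex (quarkEquiv (Nf := Nf) (L := 2 * S + 1)) quarkEquiv (Matrix.of fun v w : QuarkVar Nf (2 * S + 1) => if v.1 = w.1 ∧ v.2.1 = w.2.1 ∧ v.2.2.1 = w.2.2.1 then (if v.1 = f then (1 : ℂ) else if v.1 = g then -1 else 0) * ((μl : ℂ) * Complex.I) * gammaFive v.2.2.2 w.2.2.2 else 0); let E := fun (β m₀ μl : ℝ)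 (S : ℕ) (X : GaugeConfig 4 (2 * S + 1) (Matrix.specialUnitaryGroup (Fin 3) ℂ) → FermiAlg Nf (2 * S + 1)) => (∫ U, fermiIntegral (X U * grassmannExp (quadratic ℂ (-(diracMatrix U (fun _ : Fin Nf => m₀) + Tw S μl)))) ∂(wilsonMeasure (d := 4) (L := 2 * S + 1) (fundamentalRep (Fin 3)) β)) / (∫ U, fermiIntegral (grassmannExp (quadratic ℂ (-(diracMatrix U (fun _ : Fin Nf => m₀) + Tw S μl)))) ∂(wilsonMeasure (d := 4) (L := 2 * S + 1) (fundamentalRep (Fin 3)) β)); let TwGap := fun (t μ Δ : ℝ) => ∀ (R R' : ℕ) (A : QCDLatticeObservable Nf R) (B : QCDLatticeObservable Nf R'), ∃ Cc : ℝ, ∀ᶠ k in atTop, ∀ S : ℕ, reg.L k ≤ S → ∀ n : ℕ, n ≤ S → ‖E (reg.β k) (reg.mcrit k + reg.a k * t / reg.Zm k) (reg.a k * μ / reg.Zm k) S (fun U => A.onTorus (2 * S + 1) 0 U * B.onTorus (2 * S + 1) (Pi.single 0 (n : ℤ)) U) - E (reg.β k) (reg.mcrit k + reg.a k * t / reg.Zm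 k) (reg.a k * μ / reg.Zm k) S (A.onTorus (2 * S + 1) 0) * E (reg.β k) (reg.mcrit k + reg.a k * t / reg.Zm k) (reg.a k * μ / reg.Zm k) S (B.onTorus (2 * S + 1) (Pi.single 0 (n : ℤ)))‖ ≤ Cc * Real.exp (-(Δ * (reg.a k * n))); (TwGap t 0 Δ ↔ (reg.scheme (fun _ : Fin Nf => t) 0 0).HasLatticeMassGap Δ) := by
  intro Nf reg f g t Δ
  dsimp only
  simp only [bareTwist_zero, twist_zero, add_zero, QCDScheme.HasLatticeMassGap, qcdLatticeConnectedCorr,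
    qcdTorusExpect, fermiBoltzmann, QCDRegularisation.scheme]

end Summit.QuantumFields.QCD.Cruxes.ChiralCornerSoftness.TwistedRay

end
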